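import Literature.NumberTheory.Automorphic.UnitaryGroupPrincipalSeriesExponents        -- ★ `cmTorusCharPair` (+ ★ `UnitaryGroupBorelInduction`: `cmPrincipalSeries`, `torusU`, `scalar…`)
import Literature.NumberTheory.Automorphic.IrreducibleClassesConstituentsCentral        -- ★ p849599 (Z2a): `IrrClass.IsConstituentOf.hasCentralCharacter_of_forall_apply`
import Literature.NumberTheory.Automorphic.UnitaryGroupAutomorphicRep                   -- ★ `scalar_mem_unitaryGroupOfForm`
import Literature.NumberTheory.Rogawski1990.CMLocalAPacketMembers                       -- ★ organ vocabulary `Gqs`, `qsForm`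
import Summits.HodgeConjecture.HodgeConjecture.Theorems.F0P3cStCharTSTorusDefs         -- ★ p849564 (TOR) terms of record: `torusChart`, `coe_torusChart`
import HarnessLib

/-!
# F0 · P3c · line LH6 «StCharTS» — «PS-IRRED-CENTRAL★»: the CENTRAL CHARACTER of the principal series `i_G(χ₁, χ₂)` of `U(Φ₃)(L⁺_v)` and of
# EVERY constituent of it, explicitly on the scalars `z = ζ·1`, `ζ σ(ζ) = 1`  [Rogawski1990, §12.1 p. 171; §12.2 p. 173]

Cell `pub/hodgecm-mathlib`, crux H413 = `stmt-HodgeConjecture-24833` (`--supports` lane), route HCCMUnconditional; prover LH1-p04 (g3) on the by-name deal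
«PS-IRRED-CENTRAL★» of «LH6» F0P3b-plan (g23) 2026-09-02T05:53:33Z (the read-back the (NONL2-PAR)∕(PS1) consumers of the (S-𝔇) package need); it is also the
local brick (Z1) of LH1's «ZENTRUM» chapter (memo `F0/P3c/LH1/LH1-plan/g4/G5-ZENTRUM-PRICING.v2.md`).  THEOREMS ONLY (no `def`, no instance, no notation, no `sorry`,
no named fact).  HONEST LABEL: HC_CM is proved only modulo the 7 printed citations (2 remaining: hLiu418 = stmt-HodgeConjecture-24832, h413 = stmt-HodgeConjecture-24833)
until rung 0 closes; count-neutral.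

THE STATEMENT.  `G = Gqs L v = U(Φ₃)(L⁺_v)` (`R = LocalRing L v = ∏_{w∣v} L_w`, `σ = conjLocal`), `χ = cmTorusCharPair L v χ₁ χ₂` the pair character `d(α,β,ᾱ⁻¹) ↦ χ₁(α)χ₂(det)`
of the diagonal torus (★ `UnitaryGroupPrincipalSeriesExponents`), `i_G(χ) = cmPrincipalSeries L 3 v χ` (★ honest `normalizedInd` = `Ind_B^G(χ ∘ proj ⊗ δ_B^{1∕2})`).
For a unit `ζ` of `σ`-norm one (`ζ ∈ normOneUnits σ = E¹_v`) the scalar `z = ζ·1₃` lies in `G` (★ `scalar_mem_unitaryGroupOfForm`), is central, diagonal, and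
`χ(z) = χ₁(ζ)·χ₂(ζ³)`, `δ_B(z) = 1`; hence
* §4 (M1) `cmPrincipalSeries_apply_of_coe_eq_smul_one`: `i_G(χ)(z) f = (χ₁ ζ · χ₂ ζ³) • f` for every `z ∈ G` whose matrix is `ζ • 1`;
* §4 (M2) `apply_eq_smul_of_isConstituentOf_cmPrincipalSeries`: for EVERY constituent class `[r]` of `i_G(χ)` (★ `IrrClass.IsConstituentOf`) and EVERY representative `r`,
  `r.ρ z = (χ₁ ζ · χ₂ ζ³) • id` — the explicit central character on `z = ζ·1`, with NO hypothesis on the shape of the centre (valid at split and non-split `v`);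
* §4 (M3) `hasCentralCharacter_of_isConstituentOf_cmPrincipalSeries`: if every `z ∈ Z(G)` is such a scalar (`hZ`; at a non-split `v` this is ★
  `exists_coe_eq_scalar_of_mem_center_unitaryGroupOfForm` on the one-place model) then every constituent has central character `ω` for any `ω : Z(G) →* ℂˣ` with
  `ω(ζ·1) = χ₁ ζ · χ₂ ζ³` (★ p849599 `IrrClass.IsConstituentOf.hasCentralCharacter_of_forall_apply`) — the «`Z(Gqs) ≅ E¹`» reading, def-free;
* the `χ_ξ` instance (M1 for ★ `cmXiTorusChar`, definitional via ★ `cmXiTorusChar_eq_cmTorusCharPair`), the non-vacuity witness `exists_coe_eq_smul_one`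
  (★ `scalar_mem_unitaryGroupOfForm`) and the (TOR)-chart witness `coe_torusChart_scalar`: `torusChart L v (ζ, ζ³)` (★ p849564) has matrix `ζ • 1`.
GENERIC INPUTS proved here (§1–§3, any group): the modular character of a locally compact group is `1` on its CENTRE (`modularCharacter_eq_one_of_mem_center`: right
translation by a central `z` is left translation, Haar measure is left invariant), so `δ_P^{1∕2}(z) = 1` (`rootDeltaChar_eq_one_of_mem_center`); a central `z ∈ H` on which
`σ` acts by `c` acts by `c` on `Ind_H^G σ` (`smoothIndRep_apply_eq_smul_of_mem_center`: `(z•f)(x) = f(xz) = f(zx) = σ(z) f(x)`); a scalar action descends to every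
subquotient and along equivalences, hence to every representative of a constituent class (`apply_eq_smul_of_isConstituentOf`).
In print: «the constituents of `i_G(χ)` have central character `χ|_Z`» [Rogawski1990, §12.2 p. 173], «we identify the centre of `U(N)` with `U(1) = E¹`» [Mok2014, §1 p. 5].

References: [Rogawski1990] J. Rogawski, *Automorphic representations of unitary groups in three variables* (1990), §1.10 p. 9, §12.1 p. 171, §12.2 p. 173;
[BernsteinZelevinsky1977] I. N. Bernstein, A. V. Zelevinsky, Ann. Sci. ÉNS 10 (1977), 1.7, §2.3; [BushnellHenniart2006] §2.4, §2.6; [Mok2014] C. P. Mok, Mem. AMS 235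
(2015), §1 Notation p. 5.
-/

set_option autoImplicit false
-- the mandated namespace has the single-problem summit's repeated segment (`HodgeConjecture.HodgeConjecture`)
set_option linter.dupNamespace false

noncomputable section

open NumberField IsDedekindDomain MeasureTheory
open scoped Matrix MatrixGroups NNReal
open Literature.NumberTheory.Rogawski1990 Literature.NumberTheory.Automorphic Literature.NumberTheory.Automorphic.UnitaryGroup

namespace Summit.HodgeConjecture.HodgeConjecture.Cruxes.H413.F0P3cStCharTSPrincipalSeriesCentral

open Summit.HodgeConjecture.HodgeConjecture.Cruxes.H413.F0P3cStCharTSTorusDefs (torusChart torusChartEntries coe_torusChart)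

universe u

/-! ## §1 The modular character is trivial on the centre (any locally compact group) -/

/-- **`Δ_G(z) = 1` for `z` central** (`G` any locally compact group): right translation by `z` IS left translation by `z`, and a left Haar measure is
left invariant, so the scalar factor `map (· * z) μ ∕ μ` is `1` (Mathlib `modularCharacterFun_eq_haarScalarFactor`, `map_mul_left_eq_self`, `haarScalarFactor_self`).
[cite: BernsteinZelevinsky1977, 1.7] -/
theorem modularCharacter_eq_one_of_mem_center {G : Type*} [Group G] [TopologicalSpace G] [IsTopologicalGroup G] [LocallyCompactSpace G]
    {z : G} (hz : z ∈ Subgroup.center G) : Measure.modularCharacter z = 1 := by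
  borelize G
  change Measure.modularCharacterFun z = 1
  rw [Measure.modularCharacterFun_eq_haarScalarFactor Measure.haar z]
  have h : (fun x : G => x * z) = fun x => z * x := funext fun x => Subgroup.mem_center_iff.1 hz x
  have hmap : Measure.map (fun x : G => x * z) Measure.haar = (Measure.haar : Measure G) := by
    rw [h]; exact map_mul_left_eq_self _ z
  convert Measure.haarScalarFactor_self (Measure.haar : Measure G) using 2

/-- **`δ_P^{1∕2}(p) = 1` for `p` central in `P`** (★ `rootDeltaChar` = `√Δ_P`). [cite: BernsteinZelevinsky1977, 1.7 and §2.3] -/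
theorem rootDeltaChar_eq_one_of_mem_center {G : Type*} [Group G] [TopologicalSpace G] [IsTopologicalGroup G] (P : Subgroup G)
    [LocallyCompactSpace P] {p : P} (hp : p ∈ Subgroup.center ↥P) : rootDeltaChar P p = 1 := by
  apply rootDeltaChar_eq_one_of_deltaChar_eq_one
  ext
  rw [deltaChar_apply, modularCharacter_eq_one_of_mem_center hp, Units.val_one, NNReal.coe_one, Complex.ofReal_one]

/-! ## §2 A central element of `H` acting by a scalar on `σ` acts by that scalar on `Ind_H^G σ` -/

/-- **Central character of a smooth induction**: if `z ∈ H` is central in `G` and `σ(z) = c·1`, then `z` acts on `Ind_H^G σ` by `c` —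
`(z•f)(x) = f(x z) = f(z x) = σ(z) f(x) = c f(x)` (★ `toFun_smoothIndRep_apply`, ★ `SmoothInd.toFun_subgroup_mul`). [cite: BushnellHenniart2006, §2.4; §2.6] -/
theorem smoothIndRep_apply_eq_smul_of_mem_center {k G W : Type*} [CommRing k] [Group G] [TopologicalSpace G] [SeparatelyContinuousMul G]
    [AddCommGroup W] [Module k W]
    (H : Subgroup G) (σ : Representation k H W) {z : G} (hzH : z ∈ H) (hz : z ∈ Subgroup.center G) {c : k}
    (hσ : ∀ w : W, σ ⟨z, hzH⟩ w = c • w) (f : Representation.SmoothInd H σ) : Representation.smoothIndRep H σ z f = c • f := by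
  apply Representation.SmoothInd.ext
  funext x
  rw [Representation.toFun_smoothIndRep_apply, Representation.SmoothInd.toFun_smul, Pi.smul_apply, Subgroup.mem_center_iff.1 hz x]
  exact (Representation.SmoothInd.toFun_subgroup_mul f ⟨z, hzH⟩ x).trans (hσ _)

/-! ## §3 A scalar action descends to subquotients, along equivalences, and to every representative of a constituent class -/

section Descent

variable {G : Type u} [Group G] [TopologicalSpace G]

omit [TopologicalSpace G] in
/-- A scalar action `ρ(g) = c·1` transports along an equivalence `ρ ≃ σ` (pointwise). [cite: BushnellHenniart2006, §2.6] -/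
theorem apply_eq_smul_of_equiv {V W : Type*} [AddCommGroup V] [Module ℂ V] [AddCommGroup W] [Module ℂ W] {ρ : Representation ℂ G V}
    {σ : Representation ℂ G W} {g : G} {c : ℂ} (h : ∀ v : V, ρ g v = c • v) (φ : ρ.Equiv σ) (w : W) : σ g w = c • w := by
  have h1 := φ.toIntertwiningMap.isIntertwining ρ σ g (φ.symm w)
  rw [Representation.Equiv.coe_toIntertwiningMap, Representation.Equiv.apply_symm_apply, h, map_smul,
    Representation.Equiv.apply_symm_apply] at h1
  exact h1.symm

omit [TopologicalSpace G] in
/-- A scalar action `ρ(g) = c·1` restricts to every `G`-stable subspace (Mathlib `Subrepresentation.toRepresentation`). [cite: BushnellHenniart2006, §2.6] -/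
theorem subrepresentation_apply_eq_smul {V : Type*} [AddCommGroup V] [Module ℂ V] {ρ : Representation ℂ G V} {g : G} {c : ℂ}
    (h : ∀ v : V, ρ g v = c • v) (N : Subrepresentation ρ) (x : N.toSubmodule) : N.toRepresentation g x = c • x :=
  Subtype.ext (by
    change ρ g (x : V) = ((c • x : N.toSubmodule) : V)
    rw [h, Submodule.coe_smul])

omit [TopologicalSpace G] in
/-- A scalar action `ρ(g) = c·1` descends to every quotient `ρ ⁄ W` (Mathlib `Representation.quotient`). [cite: BushnellHenniart2006, §2.6] -/
theorem quotient_apply_eq_smul {V : Type*} [AddCommGroup V] [Module ℂ V] {ρ : Representation ℂ G V} {g : G} {c : ℂ}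
    (h : ∀ v : V, ρ g v = c • v) (W : Submodule ℂ V) (hW : ∀ g, W ≤ W.comap (ρ g)) (x : V ⧸ W) : ρ.quotient W hW g x = c • x := by
  obtain ⟨v, rfl⟩ := Submodule.mkQ_surjective W x
  rw [Submodule.mkQ_apply, Representation.quotient_apply, Submodule.mapQ_apply, h, Submodule.Quotient.mk_smul]

/-- **A scalar action descends to every representative of every constituent class**: if `ρ(g) = c·1` and `[r] ∈ Irr(G)` is a constituent of `ρ`
(★ `IrrClass.IsConstituentOf`: some `r′ ∼ r` is equivalent to a subquotient `N₁ ⁄ N₂` of `ρ`), then `r.ρ(g) = c·1` — subspace, quotient, the equivalence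
`N₁ ⁄ N₂ ≃ r′` and `r′ ≃ r` (★ `IrrClass.mk_eq_mk_iff`). [cite: Rogawski1990, §12.2 p. 173] [cite: BushnellHenniart2006, §2.6] -/
theorem apply_eq_smul_of_isConstituentOf {V : Type*} [AddCommGroup V] [Module ℂ V] {ρ : Representation ℂ G V} {g : G} {c : ℂ}
    (h : ∀ v : V, ρ g v = c • v) {r : SmoothIrrep G} (hr : (IrrClass.mk r).IsConstituentOf ρ) (w : r.V) : r.ρ g w = c • w := by
  obtain ⟨r', hr', N₁, N₂, _, ⟨e⟩⟩ := hr
  obtain ⟨e'⟩ := (IrrClass.mk_eq_mk_iff r' r).1 hr'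
  have hQ := quotient_apply_eq_smul (subrepresentation_apply_eq_smul h N₁) (N₂.toSubmodule.comap N₁.toSubmodule.subtype)
    (fun g _ hx ↦ N₂.apply_mem_toSubmodule g hx)
  exact apply_eq_smul_of_equiv (apply_eq_smul_of_equiv hQ e.symm) e' w

end Descent

/-! ## §4 `U(Φ₃)(L⁺_v)`: the scalars `ζ·1`, `ζ ∈ E¹_v`, and the central character `χ₁(ζ)·χ₂(ζ³)` of `i_G(χ₁, χ₂)` and of its constituents -/

section U3

variable (L : Type) [Field L] [NumberField L] [IsCMField L] (v : HeightOneSpectrum (𝓞 ↥(maximalRealSubfield L)))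

/-- **The scalar `ζ·1₃` lies in `U(Φ₃)(L⁺_v)`** for `ζ ∈ E¹_v` (`σ(ζ) ζ = 1`; ★ `scalar_mem_unitaryGroupOfForm`) — the non-vacuity witness of (M1)–(M3): its
matrix is `ζ • 1`. [cite: Mok2014, §1 Notation p. 5] [cite: Rogawski1990, §1.10 p. 9] -/
theorem exists_coe_eq_smul_one (ζ : ↥(normOneUnits (conjLocal L (IsCMField.complexConj L) v))) :
    ∃ z : Gqs L v, (z.val.val : Matrix (Fin 3) (Fin 3) (LocalRing L v)) =
      ((ζ : (LocalRing L v)ˣ) : LocalRing L v) • (1 : Matrix (Fin 3) (Fin 3) (LocalRing L v)) := by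
  refine ⟨⟨Units.map (Matrix.scalar (Fin 3) : LocalRing L v →+* Matrix (Fin 3) (Fin 3) (LocalRing L v)).toMonoidHom (ζ : (LocalRing L v)ˣ),
    scalar_mem_unitaryGroupOfForm _ _ _ ((mem_normOneUnits_iff _).1 ζ.2)⟩, ?_⟩
  simp [Matrix.smul_one_eq_diagonal]

/-- **In the (TOR) chart: `ζ·1₃ = ι(ζ, ζ³)`** — the chart entries `(α, z·σ(α)·α⁻¹, σ(α)⁻¹)` of ★ p849564 `torusChart` at `(α, z) = (ζ, ζ³)`, `σ(ζ) = ζ⁻¹`, are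
`(ζ, ζ, ζ)`. [cite: Rogawski1990, §12.2 p. 173] -/
theorem torusChartEntries_scalar (ζ : ↥(normOneUnits (conjLocal L (IsCMField.complexConj L) v))) :
    torusChartEntries L v ((ζ : (LocalRing L v)ˣ), ζ ^ 3) = fun _ => (ζ : (LocalRing L v)ˣ) := by
  have hσ : Units.map ((conjLocal L (IsCMField.complexConj L) v : LocalRing L v →+* LocalRing L v) : LocalRing L v →* LocalRing L v)
      (ζ : (LocalRing L v)ˣ) = (ζ : (LocalRing L v)ˣ)⁻¹ := by
    rw [eq_inv_iff_mul_eq_one]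
    apply Units.ext
    rw [Units.val_mul, Units.coe_map, MonoidHom.coe_coe, Units.val_one]
    exact (mem_normOneUnits_iff _).1 ζ.2
  funext i
  fin_cases i
  · rfl
  · show ((ζ ^ 3 : ↥(normOneUnits (conjLocal L (IsCMField.complexConj L) v))) : (LocalRing L v)ˣ) *
        Units.map ((conjLocal L (IsCMField.complexConj L) v : LocalRing L v →+* LocalRing L v) : LocalRing L v →* LocalRing L v)
          (ζ : (LocalRing L v)ˣ) * (ζ : (LocalRing L v)ˣ)⁻¹ = (ζ : (LocalRing L v)ˣ)
    rw [hσ, SubgroupClass.coe_pow]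
    group
  · show (Units.map ((conjLocal L (IsCMField.complexConj L) v : LocalRing L v →+* LocalRing L v) : LocalRing L v →* LocalRing L v)
        (ζ : (LocalRing L v)ˣ))⁻¹ = (ζ : (LocalRing L v)ˣ)
    rw [hσ, inv_inv]

/-- **The (TOR)-chart witness**: the torus element `ι(ζ, ζ³) = torusChart L v (ζ, ζ³)` of ★ p849564 has matrix `ζ • 1` — so (M1)–(M3) below apply to it
verbatim (the scalar `ζ·1₃` in the coordinates every (TOR)∕(PSM) brick uses). [cite: Rogawski1990, §12.2 p. 173] -/
theorem coe_torusChart_scalar (ζ : ↥(normOneUnits (conjLocal L (IsCMField.complexConj L) v))) :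
    (((torusChart L v ((ζ : (LocalRing L v)ˣ), ζ ^ 3) : ↥(cmBorelTriple L 3 v).M) :
        ↥(unitaryGroupOfForm (conjLocal L (IsCMField.complexConj L) v) (cmLocalForm L 3 v))).val.val : Matrix (Fin 3) (Fin 3) (LocalRing L v)) =
      ((ζ : (LocalRing L v)ˣ) : LocalRing L v) • (1 : Matrix (Fin 3) (Fin 3) (LocalRing L v)) := by
  have h := coe_torusChart L v ((ζ : (LocalRing L v)ˣ), ζ ^ 3)
  rw [torusChartEntries_scalar] at h
  change (Units.val (((torusChart L v ((ζ : (LocalRing L v)ˣ), ζ ^ 3) : ↥(cmBorelTriple L 3 v).M) :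
      ↥(unitaryGroupOfForm (conjLocal L (IsCMField.complexConj L) v) (cmLocalForm L 3 v))) : GL (Fin 3) (LocalRing L v))) = _
  rw [h, coe_glDiagonal, Matrix.smul_one_eq_diagonal]

variable {L v}

/-- An element of `U(Φ₃)(L⁺_v)` with matrix `ζ • 1` IS `diag(ζ, ζ, ζ)` (★ `glDiagonal`), so it lies in the diagonal torus `T` (★ `mem_torusU_iff`).
[cite: Rogawski1990, §1.10 p. 9] -/
theorem glDiagonal_const_eq_of_coe_eq_smul_one {z : Gqs L v} {ζ : (LocalRing L v)ˣ}
    (hz : (z.val.val : Matrix (Fin 3) (Fin 3) (LocalRing L v)) = (ζ : LocalRing L v) • (1 : Matrix (Fin 3) (Fin 3) (LocalRing L v))) :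
    glDiagonal 3 (LocalRing L v) (fun _ => ζ) = z.val := by
  refine Units.ext ?_
  rw [coe_glDiagonal, hz, Matrix.smul_one_eq_diagonal]

/-- Such a `z` lies in the diagonal torus `T = (cmBorelTriple L 3 v).M`. [cite: Rogawski1990, §1.10 p. 9] -/
theorem mem_torusU_of_coe_eq_smul_one {z : Gqs L v} {ζ : (LocalRing L v)ˣ}
    (hz : (z.val.val : Matrix (Fin 3) (Fin 3) (LocalRing L v)) = (ζ : LocalRing L v) • (1 : Matrix (Fin 3) (Fin 3) (LocalRing L v))) :
    z ∈ torusU (conjLocal L (IsCMField.complexConj L) v) (cmLocalForm L 3 v) :=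
  (mem_torusU_iff _).2 ⟨fun _ => ζ, glDiagonal_const_eq_of_coe_eq_smul_one hz⟩

/-- Such a `z` is CENTRAL in `U(Φ₃)(L⁺_v)` (`g (ζ•1) = ζ•g = (ζ•1) g`). [cite: Mok2014, §1 Notation p. 5] -/
theorem mem_center_of_coe_eq_smul_one {z : Gqs L v} {ζ : (LocalRing L v)ˣ}
    (hz : (z.val.val : Matrix (Fin 3) (Fin 3) (LocalRing L v)) = (ζ : LocalRing L v) • (1 : Matrix (Fin 3) (Fin 3) (LocalRing L v))) :
    z ∈ Subgroup.center (Gqs L v) := by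
  rw [Subgroup.mem_center_iff]
  intro g
  refine Subtype.ext (Units.ext ?_)
  change (g.val.val : Matrix (Fin 3) (Fin 3) (LocalRing L v)) * z.val.val = z.val.val * g.val.val
  rw [hz, Matrix.mul_smul, Matrix.mul_one, Matrix.smul_mul, Matrix.one_mul]

/-- Such a `z`, as an element of any subgroup `P ∋ z` of `U(Φ₃)(L⁺_v)` (the Borel `B`), is central in `P`. [cite: Mok2014, §1 Notation p. 5] -/
theorem mem_center_subgroup_of_coe_eq_smul_one {z : Gqs L v} {ζ : (LocalRing L v)ˣ}
    (hz : (z.val.val : Matrix (Fin 3) (Fin 3) (LocalRing L v)) = (ζ : LocalRing L v) • (1 : Matrix (Fin 3) (Fin 3) (LocalRing L v)))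
    (P : Subgroup (Gqs L v)) (hzP : z ∈ P) : (⟨z, hzP⟩ : ↥P) ∈ Subgroup.center ↥P := by
  rw [Subgroup.mem_center_iff]
  intro p
  exact Subtype.ext (Subgroup.mem_center_iff.1 (mem_center_of_coe_eq_smul_one hz) (p : Gqs L v))

/-- **`χ(ζ·1) = χ₁(ζ) · χ₂(ζ³)`** for the pair character `χ = cmTorusCharPair L v χ₁ χ₂` (`d ↦ χ₁(d₀₀) χ₂(det d)`; ★ `torusCharPair_apply_of_glDiagonal_eq`,
`det (ζ·1₃) = ζ³`). [cite: Rogawski1990, §12.1 p. 171] -/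
theorem cmTorusCharPair_apply_of_coe_eq_smul_one (χ₁ : (LocalRing L v)ˣ →* ℂˣ)
    (χ₂ : ↥(normOneUnits (conjLocal L (IsCMField.complexConj L) v)) →* ℂˣ) {z : Gqs L v}
    (ζ : ↥(normOneUnits (conjLocal L (IsCMField.complexConj L) v)))
    (hz : (z.val.val : Matrix (Fin 3) (Fin 3) (LocalRing L v)) =
      ((ζ : (LocalRing L v)ˣ) : LocalRing L v) • (1 : Matrix (Fin 3) (Fin 3) (LocalRing L v)))
    (hzT : z ∈ torusU (conjLocal L (IsCMField.complexConj L) v) (cmLocalForm L 3 v)) :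
    cmTorusCharPair L v χ₁ χ₂ ⟨z, hzT⟩ = χ₁ (ζ : (LocalRing L v)ˣ) * χ₂ (ζ ^ 3) := by
  unfold cmTorusCharPair
  rw [torusCharPair_apply_of_glDiagonal_eq _ _ _ 0 χ₁ χ₂ ⟨z, hzT⟩ (fun _ => (ζ : (LocalRing L v)ˣ)) (glDiagonal_const_eq_of_coe_eq_smul_one hz)]
  congr 2
  refine Subtype.ext ?_
  show (∏ _j : Fin 3, ((ζ : ↥(normOneUnits (conjLocal L (IsCMField.complexConj L) v))) : (LocalRing L v)ˣ)) =
    ((ζ ^ 3 : ↥(normOneUnits (conjLocal L (IsCMField.complexConj L) v))) : (LocalRing L v)ˣ)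
  rw [Finset.prod_const, Finset.card_univ, Fintype.card_fin, SubgroupClass.coe_pow]

set_option synthInstance.maxHeartbeats 400000 in
set_option maxHeartbeats 800000 in
/-- **(M1) `i_G(χ₁,χ₂)(ζ·1) = χ₁(ζ)·χ₂(ζ³)`**: on the principal series ★ `cmPrincipalSeries L 3 v (cmTorusCharPair L v χ₁ χ₂)` (honest normalised Borel induction)
every `z ∈ U(Φ₃)(L⁺_v)` with matrix `ζ • 1`, `ζ ∈ E¹_v`, acts by the scalar `χ₁(ζ) χ₂(ζ³)` — `z` is central and lies in `B`, the inducing character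
`(χ ∘ proj) ⊗ δ_B^{1∕2}` takes the value `χ(z) · 1` there (§1–§2, ★ `proj_apply_of_mem_M`). [cite: Rogawski1990, §12.2 p. 173; §12.1 p. 171] [cite: BernsteinZelevinsky1977, §2.3] -/
theorem cmPrincipalSeries_apply_of_coe_eq_smul_one (χ₁ : (LocalRing L v)ˣ →* ℂˣ)
    (χ₂ : ↥(normOneUnits (conjLocal L (IsCMField.complexConj L) v)) →* ℂˣ) (z : Gqs L v)
    (ζ : ↥(normOneUnits (conjLocal L (IsCMField.complexConj L) v)))
    (hz : (z.val.val : Matrix (Fin 3) (Fin 3) (LocalRing L v)) =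
      ((ζ : (LocalRing L v)ˣ) : LocalRing L v) • (1 : Matrix (Fin 3) (Fin 3) (LocalRing L v))) :
    haveI := locallyCompactSpace_cmBorelU L 3 v
    ∀ f : Representation.SmoothInd (cmBorelTriple L 3 v).P
      (Representation.twist
        (((Representation.trivial ℂ ↥(torusU (conjLocal L (IsCMField.complexConj L) v) (cmLocalForm L 3 v)) ℂ).twist
          (cmTorusCharPair L v χ₁ χ₂)).comp (cmBorelTriple L 3 v).proj) (rootDeltaChar (cmBorelTriple L 3 v).P)),
      cmPrincipalSeries L 3 v (cmTorusCharPair L v χ₁ χ₂) z f = (((χ₁ (ζ : (LocalRing L v)ˣ) * χ₂ (ζ ^ 3) : ℂˣ) : ℂ)) • f := by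
  haveI := locallyCompactSpace_cmBorelU L 3 v
  intro f
  have hzT := mem_torusU_of_coe_eq_smul_one hz
  have hzP : z ∈ (cmBorelTriple L 3 v).P := torusU_le_borelU _ _ hzT
  have hzc : z ∈ Subgroup.center ↥(unitaryGroupOfForm (conjLocal L (IsCMField.complexConj L) v) (cmLocalForm L 3 v)) :=
    mem_center_of_coe_eq_smul_one hz
  have hproj : (cmBorelTriple L 3 v).proj ⟨z, hzP⟩ = ⟨z, hzT⟩ :=
    Subtype.ext ((cmBorelTriple L 3 v).proj_apply_of_mem_M ⟨z, hzP⟩ hzT)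
  have hδ : rootDeltaChar (cmBorelTriple L 3 v).P ⟨z, hzP⟩ = 1 :=
    rootDeltaChar_eq_one_of_mem_center _ (mem_center_subgroup_of_coe_eq_smul_one hz _ hzP)
  have key : ∀ w : ℂ,
      (Representation.twist
        (((Representation.trivial ℂ ↥(torusU (conjLocal L (IsCMField.complexConj L) v) (cmLocalForm L 3 v)) ℂ).twist
          (cmTorusCharPair L v χ₁ χ₂)).comp (cmBorelTriple L 3 v).proj) (rootDeltaChar (cmBorelTriple L 3 v).P)) ⟨z, hzP⟩ w =
        (((χ₁ (ζ : (LocalRing L v)ˣ) * χ₂ (ζ ^ 3) : ℂˣ) : ℂ)) • w := fun w => by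
    rw [Representation.twist_apply, hδ, Units.val_one, one_smul, MonoidHom.coe_comp, Function.comp_apply, hproj,
      Representation.twist_apply, Representation.trivial_apply, cmTorusCharPair_apply_of_coe_eq_smul_one χ₁ χ₂ ζ hz hzT]
  exact smoothIndRep_apply_eq_smul_of_mem_center
    (G := ↥(unitaryGroupOfForm (conjLocal L (IsCMField.complexConj L) v) (cmLocalForm L 3 v))) _ _ hzP hzc key f

set_option synthInstance.maxHeartbeats 400000 in
set_option maxHeartbeats 800000 in
/-- **(M2) EVERY CONSTITUENT of `i_G(χ₁,χ₂)` has central character `χ₁(ζ)·χ₂(ζ³)` on `ζ·1`**: for every class `[r] ∈ Irr(U(Φ₃)(L⁺_v))` that is a constituent of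
★ `cmPrincipalSeries L 3 v (cmTorusCharPair L v χ₁ χ₂)` (★ `IrrClass.IsConstituentOf`), EVERY representative `r`, and every `z` with matrix `ζ • 1` (`ζ ∈ E¹_v`):
`r.ρ(z) = χ₁(ζ)χ₂(ζ³) · 1` — (M1) descended to subquotients (§3).  No hypothesis on the centre; split and non-split `v` alike.
[cite: Rogawski1990, §12.2 p. 173; §12.1 p. 171] [cite: BushnellHenniart2006, §2.6] -/
theorem apply_eq_smul_of_isConstituentOf_cmPrincipalSeries (χ₁ : (LocalRing L v)ˣ →* ℂˣ)
    (χ₂ : ↥(normOneUnits (conjLocal L (IsCMField.complexConj L) v)) →* ℂˣ) {r : SmoothIrrep (Gqs L v)}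
    (hr : (IrrClass.mk r).IsConstituentOf (cmPrincipalSeries L 3 v (cmTorusCharPair L v χ₁ χ₂))) (z : Gqs L v)
    (ζ : ↥(normOneUnits (conjLocal L (IsCMField.complexConj L) v)))
    (hz : (z.val.val : Matrix (Fin 3) (Fin 3) (LocalRing L v)) =
      ((ζ : (LocalRing L v)ˣ) : LocalRing L v) • (1 : Matrix (Fin 3) (Fin 3) (LocalRing L v))) :
    r.ρ z = (((χ₁ (ζ : (LocalRing L v)ˣ) * χ₂ (ζ ^ 3) : ℂˣ) : ℂ)) • (LinearMap.id : r.V →ₗ[ℂ] r.V) :=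
  LinearMap.ext fun w => apply_eq_smul_of_isConstituentOf (cmPrincipalSeries_apply_of_coe_eq_smul_one χ₁ χ₂ z ζ hz) hr w

set_option synthInstance.maxHeartbeats 400000 in
set_option maxHeartbeats 1600000 in
/-- **(M1) on the centre**: if every central `z` of `U(Φ₃)(L⁺_v)` is a scalar `ζ·1` (`hZ`) and `ω(ζ·1) = χ₁(ζ)χ₂(ζ³)` (`hω`), then every central `z` acts on
`i_G(χ₁,χ₂)` by `ω(z)`. [cite: Rogawski1990, §12.2 p. 173] [cite: Mok2014, §1 Notation p. 5] -/
theorem cmPrincipalSeries_apply_center (χ₁ : (LocalRing L v)ˣ →* ℂˣ)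
    (χ₂ : ↥(normOneUnits (conjLocal L (IsCMField.complexConj L) v)) →* ℂˣ)
    (hZ : ∀ z : Subgroup.center (Gqs L v), ∃ ζ : ↥(normOneUnits (conjLocal L (IsCMField.complexConj L) v)),
      ((z : Gqs L v).val.val : Matrix (Fin 3) (Fin 3) (LocalRing L v)) =
        ((ζ : (LocalRing L v)ˣ) : LocalRing L v) • (1 : Matrix (Fin 3) (Fin 3) (LocalRing L v)))
    (ω : Subgroup.center (Gqs L v) →* ℂˣ)
    (hω : ∀ (z : Subgroup.center (Gqs L v)) (ζ : ↥(normOneUnits (conjLocal L (IsCMField.complexConj L) v))),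
      ((z : Gqs L v).val.val : Matrix (Fin 3) (Fin 3) (LocalRing L v)) =
        ((ζ : (LocalRing L v)ˣ) : LocalRing L v) • (1 : Matrix (Fin 3) (Fin 3) (LocalRing L v)) →
      ω z = χ₁ (ζ : (LocalRing L v)ˣ) * χ₂ (ζ ^ 3))
    (z : Subgroup.center (Gqs L v)) :
    haveI := locallyCompactSpace_cmBorelU L 3 v
    ∀ f : Representation.SmoothInd (cmBorelTriple L 3 v).P
      (Representation.twist
        (((Representation.trivial ℂ ↥(torusU (conjLocal L (IsCMField.complexConj L) v) (cmLocalForm L 3 v)) ℂ).twist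
          (cmTorusCharPair L v χ₁ χ₂)).comp (cmBorelTriple L 3 v).proj) (rootDeltaChar (cmBorelTriple L 3 v).P)),
      cmPrincipalSeries L 3 v (cmTorusCharPair L v χ₁ χ₂) (z : Gqs L v) f = ((ω z : ℂˣ) : ℂ) • f := by
  haveI := locallyCompactSpace_cmBorelU L 3 v
  intro f
  obtain ⟨ζ, hζ⟩ := hZ z
  exact (cmPrincipalSeries_apply_of_coe_eq_smul_one χ₁ χ₂ (z : Gqs L v) ζ hζ f).trans
    (congrArg (fun c : ℂ => c • f) (congrArg Units.val (hω z ζ hζ)).symm)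

set_option synthInstance.maxHeartbeats 400000 in
set_option maxHeartbeats 800000 in
/-- **(M3) CENTRAL CHARACTER of the constituents (the «`Z(U(Φ₃)) = E¹`» reading, def-free)**: if every central element of `U(Φ₃)(L⁺_v)` is a scalar `ζ·1`,
`ζ ∈ E¹_v` (`hZ` — at a non-split `v` ★ `exists_coe_eq_scalar_of_mem_center_unitaryGroupOfForm` on the one-place model), then every constituent `c` of
`i_G(χ₁,χ₂)` HAS CENTRAL CHARACTER `ω` (★ `IrrClass.HasCentralCharacter`) for any character `ω` of the centre with `ω(ζ·1) = χ₁(ζ)·χ₂(ζ³)` (`hω`) — ★ p849599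
`IrrClass.IsConstituentOf.hasCentralCharacter_of_forall_apply` over (M1). [cite: Rogawski1990, §12.2 p. 173] [cite: Mok2014, §1 Notation p. 5] [cite: BushnellHenniart2006, §2.6] -/
theorem hasCentralCharacter_of_isConstituentOf_cmPrincipalSeries (χ₁ : (LocalRing L v)ˣ →* ℂˣ)
    (χ₂ : ↥(normOneUnits (conjLocal L (IsCMField.complexConj L) v)) →* ℂˣ)
    (hZ : ∀ z : Subgroup.center (Gqs L v), ∃ ζ : ↥(normOneUnits (conjLocal L (IsCMField.complexConj L) v)),
      ((z : Gqs L v).val.val : Matrix (Fin 3) (Fin 3) (LocalRing L v)) =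
        ((ζ : (LocalRing L v)ˣ) : LocalRing L v) • (1 : Matrix (Fin 3) (Fin 3) (LocalRing L v)))
    (ω : Subgroup.center (Gqs L v) →* ℂˣ)
    (hω : ∀ (z : Subgroup.center (Gqs L v)) (ζ : ↥(normOneUnits (conjLocal L (IsCMField.complexConj L) v))),
      ((z : Gqs L v).val.val : Matrix (Fin 3) (Fin 3) (LocalRing L v)) =
        ((ζ : (LocalRing L v)ˣ) : LocalRing L v) • (1 : Matrix (Fin 3) (Fin 3) (LocalRing L v)) →
      ω z = χ₁ (ζ : (LocalRing L v)ˣ) * χ₂ (ζ ^ 3))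
    {c : IrrClass (Gqs L v)} (hc : c.IsConstituentOf (cmPrincipalSeries L 3 v (cmTorusCharPair L v χ₁ χ₂))) :
    c.HasCentralCharacter ω := by
  exact hc.hasCentralCharacter_of_forall_apply (cmPrincipalSeries_apply_center χ₁ χ₂ hZ ω hω)

set_option synthInstance.maxHeartbeats 400000 in
set_option maxHeartbeats 800000 in
/-- **(M1) for `χ_ξ`**: the case-(2) character ★ `cmXiTorusChar L v μ η₁ η₂ = cmTorusCharPair L v (η̃₁·μ·‖·‖^{1∕2}) η₂` (★ `cmXiTorusChar_eq_cmTorusCharPair`), so on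
`i_G(χ_ξ)` the scalar `ζ·1` acts by `(η₁ (ζ∕σζ) · μ ζ · ‖ζ‖^{1∕2}) · η₂(ζ³)`. [cite: Rogawski1990, §12.2 p. 174] -/
theorem cmPrincipalSeries_xi_apply_of_coe_eq_smul_one (μ : (LocalRing L v)ˣ →* ℂˣ)
    (η₁ η₂ : ↥(normOneUnits (conjLocal L (IsCMField.complexConj L) v)) →* ℂˣ) (z : Gqs L v)
    (ζ : ↥(normOneUnits (conjLocal L (IsCMField.complexConj L) v)))
    (hz : (z.val.val : Matrix (Fin 3) (Fin 3) (LocalRing L v)) =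
      ((ζ : (LocalRing L v)ˣ) : LocalRing L v) • (1 : Matrix (Fin 3) (Fin 3) (LocalRing L v))) :
    haveI := locallyCompactSpace_cmBorelU L 3 v
    ∀ f : Representation.SmoothInd (cmBorelTriple L 3 v).P
      (Representation.twist
        (((Representation.trivial ℂ ↥(torusU (conjLocal L (IsCMField.complexConj L) v) (cmLocalForm L 3 v)) ℂ).twist
          (cmXiTorusChar L v μ η₁ η₂)).comp (cmBorelTriple L 3 v).proj) (rootDeltaChar (cmBorelTriple L 3 v).P)),
    cmPrincipalSeries L 3 v (cmXiTorusChar L v μ η₁ η₂) z f =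
      ((((η₁.comp (quotConj (conjLocal L (IsCMField.complexConj L) v) (conjLocal_conjLocal_cm L v)) * μ * halfModulusChar (LocalRing L v))
          (ζ : (LocalRing L v)ˣ) * η₂ (ζ ^ 3) : ℂˣ) : ℂ)) • f :=
  cmPrincipalSeries_apply_of_coe_eq_smul_one _ η₂ z ζ hz

end U3

end Summit.HodgeConjecture.HodgeConjecture.Cruxes.H413.F0P3cStCharTSPrincipalSeriesCentral

end
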